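import Summits.BirchSwinnertonDyer.BirchSwinnertonDyer.Theorems.ByReductionTypeAtTwoOrdKatoHalfAtTwoIsoConjATwoOfNarrowRankLayerModels
import Literature.NumberTheory.IwasawaTheory.NarrowRankLayerPairExact
import HarnessLib

/-!
# Route `ByReductionTypeAtTwo`, crux `OrdKatoHalfAtTwoIso` (stmt-BirchSwinnertonDyer-19573), the `0 < Δ` cell: Coates–Sujatha's (A) at `2` for a cubic
# model whose totally real point field `ℚ(β)` has ODD narrow class number and `t` primes ramified in `ℚ(β, √2)`, from ONE narrow `2`-rank:
# `[Cl⁺(ℚ(β)_2) : Cl⁺(ℚ(β)_2)²] = 2^{t−1}` (narrow genus theory makes the layer-`1` rank KERNEL)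

`--supports stmt-BirchSwinnertonDyer-19573` file of the width seat `cruxlead-stmt-BirchSwinnertonDyer-19573-w2` GEN 12 (cell `bsd-2adic`). THEOREMS ONLY
(no definition, no named fact, no `sorry`). Closes nothing: Q⁺, G11⁺ and the crux remain OPEN; no certificate is asserted for any curve here; BSD is not
proved by any of this.

WHAT.  GEN 11's rung door `NarrowRankRung.conjA_two_cubicModel_of_narrowRank_layer_succ_eq … 1 …` consumes the EQUALITY of the narrow `2`-ranks at the layers
`1` and `2` of the cubic tower `ℚ(β)_j` — two numerical data per row in k4's census (`conjA_two_<L>_of_narrowRankEq₁₂`).  By the exact narrow genus theory of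
this seat (`Literature/…/NarrowRankLayerPairExact.lean`, `index_range_pow_two_narrowClassGroup_layer_one_mul_two_eq_two_pow`: `h⁺(ℚ(β))` odd ⟹
`[Cl⁺(ℚ(β)_1) : Cl⁺(ℚ(β)_1)²] · 2 = 2^t`, `t` the number of primes of `ℚ(β)` ramified in a model `L ≅ ℚ(β)(√2)`) the layer-`1` value is KERNEL, so the rung
`1` needs ONE datum: the narrow `2`-rank of the layer `2` (degree `12` over `ℚ`).

* ★ **`conjA_two_cubicModel_of_odd_narrowClassNumber_of_narrowRank_layer_two`** — cubic model `y² = x³ + px² + qx + r` (irreducible, `β` a root, `ℚ(β)` totally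
  real with `h⁺(ℚ(β))` odd), a totally real Galois quadratic `L ⊇ ℚ(β)` containing `θ`, `θ² = 2`, with `∏_𝔭 e_𝔭(L/ℚ(β)) = 2^t`, and for every cyclotomic
  `ℤ₂`-extension `κP` of `ℚ(β)` the ONE datum `[Cl⁺(κP.layer 2) : Cl⁺(κP.layer 2)²] · 2 = 2^t` ⟹ (A)₂ for `⟨0, p, 0, q, r⟩` at every cyclotomic `κ` of `ℚ`.
* `conjA_two_cubicModel_of_odd_narrowClassNumber_of_narrowRank_layer_two_eq_two` — the two-prime reading `t = 2` (`∏ e_𝔭 = 4`): datum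
  `[Cl⁺(κP.layer 2) : Cl⁺(κP.layer 2)²] = 2` (rank ONE at layer `2`) — the shape of the five C1″/C3″ rows 261648q1 · 279440c1 · 293200be1 · 412992bw1 · 467928d1
  (`h⁺(ℚ(θ)) = 1`, two primes above `2`, k4-w2 GEN 12 census).

Honest scope: a property of the number field `ℚ(β)` is consumed, nothing is asserted about any field or curve.

References: [Fukuda1994] Thm. 1 (2), p. 264; [Gras2003] IV.4; [Washington1997] §13.1; [CoatesSujatha2005] Conj. A; tree p746171 (GEN 11 rung door), p750257
(layer-pair exact rank), p749976 (narrow genus `2`-rank).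
-/

set_option autoImplicit false
-- sibling precedent (`…ConjATwoOfNarrowRankLayerModels.lean`): the directory name repeats the summit name
set_option linter.dupNamespace false

noncomputable section

open scoped Classical NumberField IntermediateField Polynomial

namespace Summit.BirchSwinnertonDyer.BirchSwinnertonDyer.Theorems.SteinbergFibreAtTwo.NarrowRankRung

open WeierstrassCurve NumberField IsDedekindDomain Field Polynomial
open Literature.NumberTheory.EllipticCurves Literature.NumberTheory.EllipticCurves.ZpExtension
  Literature.NumberTheory.GaloisRepresentations Literature.NumberTheory.IwasawaTheory Literature.NumberTheory.NumberFields
  Literature.NumberTheory.EllipticCurves.Rank1Residual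
open Summit.BirchSwinnertonDyer.BirchSwinnertonDyer.Theorems.AlignedTransportAtTwoTorsionPointField
open Summit.BirchSwinnertonDyer.BirchSwinnertonDyer.Theorems.SteinbergFibreAtTwo
open Summit.BirchSwinnertonDyer.BirchSwinnertonDyer.Theses.ByReductionTypeAtTwo

/-- ★ **(A)₂ for a cubic model from `h⁺(ℚ(β))` odd, `t` primes ramified in `ℚ(β,√2)`, and ONE narrow `2`-rank at layer `2`.**  `y² = x³ + px² + qx + r`
irreducible, `β` a root with `ℚ(β)` totally real and `h⁺(ℚ(β))` odd; `L ⊇ ℚ(β)` Galois of degree `2`, totally real, `θ² = 2` in `L` (a model of `ℚ(β)_1`) with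
`∏_𝔭 e_𝔭(L/ℚ(β)) = 2^t`; datum: for every cyclotomic `ℤ₂`-extension `κP` of `ℚ(β)`, `[Cl⁺(κP.layer 2) : Cl⁺(κP.layer 2)²] · 2 = 2^t` (rank `t − 1` at layer `2`).
Then (A)₂ holds for `⟨0, p, 0, q, r⟩` at every cyclotomic `κ` of `ℚ`: the layer-`1` rank is `t − 1` by narrow genus theory
(`index_range_pow_two_narrowClassGroup_layer_one_mul_two_eq`), so the rung `m = 1` of `conjA_two_cubicModel_of_narrowRank_layer_succ_eq` fires.
[cite: Fukuda1994, Thm. 1 (2), p. 264] [cite: Gras2003, IV.4] [cite: CoatesSujatha2005, §3 Conj. A and Thm. 3.4] -/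
theorem conjA_two_cubicModel_of_odd_narrowClassNumber_of_narrowRank_layer_two (p q r : ℤ)
    [((⟨0, (p : ℚ), 0, (q : ℚ), (r : ℚ)⟩ : WeierstrassCurve ℚ)).IsElliptic]
    (hirr : Irreducible (Cubic.toPoly ⟨1, (p : ℚ), q, r⟩))
    {β : AlgebraicClosure ℚ} (hβ : aeval β (Cubic.toPoly ⟨1, (p : ℚ), q, r⟩) = 0)
    [NumberField ↥(IntermediateField.adjoin ℚ ({β} : Set (AlgebraicClosure ℚ)))]
    [IsTotallyReal ↥(IntermediateField.adjoin ℚ ({β} : Set (AlgebraicClosure ℚ)))]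
    (hK : Odd (narrowClassNumber ↥(IntermediateField.adjoin ℚ ({β} : Set (AlgebraicClosure ℚ)))))
    (L : Type) [Field L] [NumberField L] [Algebra ↥(IntermediateField.adjoin ℚ ({β} : Set (AlgebraicClosure ℚ))) L]
    [IsGalois ↥(IntermediateField.adjoin ℚ ({β} : Set (AlgebraicClosure ℚ))) L] [IsTotallyReal L]
    (hL : Module.finrank ↥(IntermediateField.adjoin ℚ ({β} : Set (AlgebraicClosure ℚ))) L = 2) (θ : L) (hθ : θ ^ 2 = 2)
    (t : ℕ) (ht : (∏ᶠ v : HeightOneSpectrum (𝓞 ↥(IntermediateField.adjoin ℚ ({β} : Set (AlgebraicClosure ℚ)))),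
      v.asIdeal.ramificationIdxIn (𝓞 L)) = 2 ^ t)
    (hcert : ∀ κP : ZpExtension ↥(IntermediateField.adjoin ℚ ({β} : Set (AlgebraicClosure ℚ))) 2, κP.IsCyclotomic →
      ∀ [NumberField ↥(κP.layer 2)], (powMonoidHom (α := NarrowClassGroup ↥(κP.layer 2)) 2).range.index * 2 = 2 ^ t)
    (κ : ZpExtension ℚ 2) (hκ : κ.IsCyclotomic) :
    ∃ (γ : absoluteGaloisGroup ℚ) (Dd : ((⟨0, (p : ℚ), 0, (q : ℚ), (r : ℚ)⟩ : WeierstrassCurve ℚ)).FineSelmerDualData κ γ),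
      Module.Finite ℤ_[2] (RestrictScalars ℤ_[2] (IwasawaAlgebra 2) Dd.X) := by
  haveI : Fact (Nat.Prime 2) := ⟨Nat.prime_two⟩
  have hmonic : (Cubic.toPoly ⟨1, (p : ℚ), q, r⟩).Monic := Cubic.monic_of_a_eq_one rfl
  have hβint : IsIntegral ℚ β := ⟨_, hmonic, by rwa [← aeval_def]⟩
  have h3 : Module.finrank ℚ ↥(IntermediateField.adjoin ℚ ({β} : Set (AlgebraicClosure ℚ))) = 3 := by
    rw [IntermediateField.adjoin.finrank hβint, ← minpoly.eq_of_irreducible_of_monic hirr hβ hmonic]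
    exact Cubic.natDegree_of_a_ne_zero' one_ne_zero
  have hdeg : Odd (Module.finrank ℚ ↥(IntermediateField.adjoin ℚ ({β} : Set (AlgebraicClosure ℚ)))) := by
    rw [h3]; exact ⟨1, rfl⟩
  have hcert' : ∀ κP : ZpExtension ↥(IntermediateField.adjoin ℚ ({β} : Set (AlgebraicClosure ℚ))) 2, κP.IsCyclotomic →
      ∀ [NumberField ↥(κP.layer 1)] [NumberField ↥(κP.layer (1 + 1))],
        (powMonoidHom (α := NarrowClassGroup ↥(κP.layer (1 + 1))) 2).range.index =
          (powMonoidHom (α := NarrowClassGroup ↥(κP.layer 1)) 2).range.index := by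
    intro κP hκP _ _
    have h1 := (index_range_pow_two_narrowClassGroup_layer_one_mul_two_eq hdeg κP hκP L hL θ hθ hK).trans ht
    haveI : NumberField ↥(κP.layer 2) := ‹NumberField ↥(κP.layer (1 + 1))›
    have h2 : (powMonoidHom (α := NarrowClassGroup ↥(κP.layer 2)) 2).range.index * 2 = 2 ^ t := hcert κP hκP
    apply Nat.eq_of_mul_eq_mul_right two_pos
    exact h2.trans h1.symm
  exact conjA_two_cubicModel_of_narrowRank_layer_succ_eq p q r hirr hβ 1 le_rfl hcert' κ hκ

/-- **The two-prime reading (`t = 2`): datum «rank₂ Cl⁺(ℚ(β)_2) = 1».**  Same hypotheses with `∏_𝔭 e_𝔭(L/ℚ(β)) = 4` (two primes of `ℚ(β)` ramify in the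
model `L` of `ℚ(β)(√2)`, each with `e = 2`) and, for every cyclotomic `κP`, `[Cl⁺(κP.layer 2) : Cl⁺(κP.layer 2)²] = 2` ⟹ (A)₂ for `⟨0, p, 0, q, r⟩` at every
cyclotomic `κ` of `ℚ`.  Shape of the census rows with `h⁺(ℚ(θ)) = 1` and two primes above `2` (k4-w2 GEN 12: 261648q1, 279440c1, 293200be1, 412992bw1, 467928d1),
whose layer-`1` narrow rank is `1` by KERNEL (`index_range_pow_two_narrowClassGroup_layer_one_mul_two_eq_two_pow`), not by numerics.
[cite: Fukuda1994, Thm. 1 (2), p. 264] [cite: Gras2003, IV.4] [cite: CoatesSujatha2005, §3 Conj. A and Thm. 3.4] -/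
theorem conjA_two_cubicModel_of_odd_narrowClassNumber_of_narrowRank_layer_two_eq_two (p q r : ℤ)
    [((⟨0, (p : ℚ), 0, (q : ℚ), (r : ℚ)⟩ : WeierstrassCurve ℚ)).IsElliptic]
    (hirr : Irreducible (Cubic.toPoly ⟨1, (p : ℚ), q, r⟩))
    {β : AlgebraicClosure ℚ} (hβ : aeval β (Cubic.toPoly ⟨1, (p : ℚ), q, r⟩) = 0)
    [NumberField ↥(IntermediateField.adjoin ℚ ({β} : Set (AlgebraicClosure ℚ)))]
    [IsTotallyReal ↥(IntermediateField.adjoin ℚ ({β} : Set (AlgebraicClosure ℚ)))]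
    (hK : Odd (narrowClassNumber ↥(IntermediateField.adjoin ℚ ({β} : Set (AlgebraicClosure ℚ)))))
    (L : Type) [Field L] [NumberField L] [Algebra ↥(IntermediateField.adjoin ℚ ({β} : Set (AlgebraicClosure ℚ))) L]
    [IsGalois ↥(IntermediateField.adjoin ℚ ({β} : Set (AlgebraicClosure ℚ))) L] [IsTotallyReal L]
    (hL : Module.finrank ↥(IntermediateField.adjoin ℚ ({β} : Set (AlgebraicClosure ℚ))) L = 2) (θ : L) (hθ : θ ^ 2 = 2)
    (ht : (∏ᶠ v : HeightOneSpectrum (𝓞 ↥(IntermediateField.adjoin ℚ ({β} : Set (AlgebraicClosure ℚ)))),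
      v.asIdeal.ramificationIdxIn (𝓞 L)) = 4)
    (hcert : ∀ κP : ZpExtension ↥(IntermediateField.adjoin ℚ ({β} : Set (AlgebraicClosure ℚ))) 2, κP.IsCyclotomic →
      ∀ [NumberField ↥(κP.layer 2)], (powMonoidHom (α := NarrowClassGroup ↥(κP.layer 2)) 2).range.index = 2)
    (κ : ZpExtension ℚ 2) (hκ : κ.IsCyclotomic) :
    ∃ (γ : absoluteGaloisGroup ℚ) (Dd : ((⟨0, (p : ℚ), 0, (q : ℚ), (r : ℚ)⟩ : WeierstrassCurve ℚ)).FineSelmerDualData κ γ),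
      Module.Finite ℤ_[2] (RestrictScalars ℤ_[2] (IwasawaAlgebra 2) Dd.X) :=
  conjA_two_cubicModel_of_odd_narrowClassNumber_of_narrowRank_layer_two p q r hirr hβ hK L hL θ hθ 2
    (by rw [ht]; norm_num) (fun κP hκP _ => by rw [hcert κP hκP]; norm_num) κ hκ

end Summit.BirchSwinnertonDyer.BirchSwinnertonDyer.Theorems.SteinbergFibreAtTwo.NarrowRankRung

end
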